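import Summits.BirchSwinnertonDyer.BirchSwinnertonDyer.Theorems.SignedBaseChangeAnticyclotomicEisensteinDivisibilityAdmdefRankOneDictionary
import Summits.BirchSwinnertonDyer.Rank1Residual.GaloisImage.SelmerLocalConditionTamagawaFree
import HarnessLib

/-!
# Line `admdef` (crux `AnticyclotomicEisensteinDivisibility`, stmt-BirchSwinnertonDyer-20727), rigidity road: the bad-place identity (KU) of the
# rank-one dictionary DISCHARGED from (Tam) «`p ∤ c_v(E/K)`» — Howard's criterion at the root mod `𝔪` with ALL hypotheses standard

LEAD seat bsd-line-sbc-p1 (gen 29), `--supports stmt-BirchSwinnertonDyer-20727` (helper; OFF the v23 composition path).  `…AdmdefRankOneDictionary`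
(this seat) carries at the BAD places `v ∤ p` the explicit hypothesis (KU) «unramified at every `𝔓 ∣ v` = Kummer at `v`» for classes of `H¹(K, E[p])`.
The tree PROVES it at every finite place `v ∤ p` — ANY reduction type — whose local Tamagawa number `c_v` is prime to `p`
(`Summit.BirchSwinnertonDyer.Rank1Residual.GaloisImage.InertiaDivisible.selmerLocalKer_eq_unramifiedKer_of_not_dvd_localTamagawaNumber_pow`:
Milne *ADT* I Prop. 3.8 / Remark 3.10 — `H¹(K_v^nr/K_v, E(K_v^nr)) ≅ H¹(k_v, Φ_v)` has order `c_v` — with Greenberg's Néron-component road for the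
converse inclusion).  THIS FILE plugs it in:
* §1 `kummer_iff_unramified_of_not_dvd_localTamagawaNumber` — (KU) at every bad `v ∤ p` with `p ∤ c_v(E/K)` (the printed hypothesis (Tam) of
  Hatley–Lei–Vigni 2022 §1.2 «`p` does not divide `#(E/E⁰)`», here place by place and only at the bad places, where it has content).
* §2 `resH1Hom_layerZero_mem_signedOrdSelmerTorsion_one_iff_mem_selmerGroup_of_tam` — the rank-one DICTIONARY under (Tam):
  `T X ∈ Sel^ε_1(K_0, E[p]) ⟺ X ∈ Sel_p(E/K)`.
* §3 `limitBaseClass_layer_zero_one_ne_zero_of_hasUnitLambda_of_selmerGroup_line_of_tam` — **Howard 2006 Thm. 3.2.3 (c) at the ROOT mod `𝔪` for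
  CHKLL25's signed bipartite systems on the all-ramified cell, every hypothesis now STANDARD**: [NV] `B.HasUnitLambda N` + `AcSigned.Setting` (p odd, good
  supersingular, `a_p = 0`, `K` imaginary quadratic, `p` split, `κ` anticyclotomic, `p ∤ h_K`) + the named print fact {Hatley–Lei–Vigni 2022 Lemma 3.7,
  local form} + (Tam) «`p ∤ c_v(E/K)` at the bad `v ∤ p`» + binder (ii) «`E[p]` ramified at every `q ∣ N`» + `(N, d_K) = 1` + `p ≥ 5`, `ρ̄_{E,p}`
  onto, every `ℓ ∣ N` split + «the classical `p`-Selmer group `Sel_p(E/K) ⊆ H¹(K, E[p])` is a line `ℤ·s`, `s ≠ 0`» ⟹ **`z_{0,1} ≠ 0`**.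

HONEST FRAMING: theorems only (no definition, no named fact, no `sorry`); the named fact is a HYPOTHESIS (conditional result); nothing about the
crux, the anchors (K1) or BSD is asserted; no summit statement is proved.  Remark (not used): on the all-ramified cell with `p ≥ 5`, (Tam) at the bad
places is automatic in print (`E[p]` ramified at a multiplicative `v` ⟺ `p ∤ ord_v(Δ) = #Φ_v(k̄)`; additive `v`: `c_v ≤ 4`) — Tate ∕ Kodaira–Néron, not
derived here.

References: [cite: MilneADT2006, Ch. I Prop. 3.8 and Remark 3.10] [cite: GreenbergLNM1716, §3 Lemma 3.3 and the remark after its proof]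
[cite: HatleyLeiVigni2022, §1.2 (Tam), Lemma 3.7] [cite: Howard2006, Thm. 3.2.3 (c)] [cite: CastellaEtAl2025, §7.2, Thm. 7.4, Thm. 7.5 (arXiv:2308.10474v2 pp. 29–31)].
-/

-- D-0017: single-problem summit, the namespace repeats the problem name by design.
set_option linter.dupNamespace false
set_option autoImplicit false

noncomputable section

open scoped Classical NumberField Pointwise

namespace Summit.BirchSwinnertonDyer.BirchSwinnertonDyer.Theorems.SignedBaseChangeAcDivAdmdefRankOneTamagawa

open WeierstrassCurve NumberField IsDedekindDomain Field
open Literature.NumberTheory.EllipticCurves Literature.NumberTheory.GaloisRepresentations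
open Literature.NumberTheory.EllipticCurves.CastellaHsuKunduLeeLiu2025
open Literature.NumberTheory.EllipticCurves.BertoliniDarmon2005
open Literature.NumberTheory.EllipticCurves.AcSigned
open Summit.BirchSwinnertonDyer.BirchSwinnertonDyer.Theorems.AdditiveKoly
open Summit.BirchSwinnertonDyer.BirchSwinnertonDyer.Theorems.SignedBaseChangeAcDivAdmdefCoreRootOfSeenAnchor
open Summit.BirchSwinnertonDyer.BirchSwinnertonDyer.Theorems.SignedBaseChangeAcDivAdmdefRankOneDictionary
open Summit.BirchSwinnertonDyer.Rank1Residual.GaloisImage.InertiaDivisible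

universe u

/-! ## §1 (KU) at a Tamagawa-free bad place -/

section Tam

variable {K : Type} [Field K] [NumberField K] (W : WeierstrassCurve ℚ) [W.IsElliptic] {p : ℕ} [Fact p.Prime]

/-- **(KU) from (Tam)**: at every bad finite place `v ∤ p` of `E/K` with `p ∤ c_v(E/K)`, a class `X ∈ H¹(K, E[p])` is unramified at every prime
`𝔓 ∣ v` of `K̄` iff it satisfies the Kummer condition at `K_v` — the tree's `selmerLocalKer_eq_unramifiedKer_of_not_dvd_localTamagawaNumber_pow`
(Milne I Prop. 3.8 / Remark 3.10, Greenberg's Néron-component road; ANY reduction type), in the shape of the hypothesis `hbad` of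
`…AdmdefRankOneDictionary`. [cite: MilneADT2006, Ch. I Prop. 3.8 and Remark 3.10] [cite: GreenbergLNM1716, §3 Lemma 3.3] -/
theorem kummer_iff_unramified_of_not_dvd_localTamagawaNumber
    (htam : ∀ v : HeightOneSpectrum (𝓞 K), ¬ (W.baseChange K).HasGoodReductionAt v → ((p : ℕ) : 𝓞 K) ∉ v.asIdeal →
      ¬ p ∣ ((W.baseChange K).baseChange (v.adicCompletion K)).localTamagawaNumber (v.adicCompletionIntegers K)) :
    ∀ v : HeightOneSpectrum (𝓞 K), ¬ (W.baseChange K).HasGoodReductionAt v → ((p : ℕ) : 𝓞 K) ∉ v.asIdeal → ∀ X : Vp W K p,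
      (∀ 𝔓 ∈ v.primesAbove, X ∈ unramifiedKer (geomTorsion (W.baseChange K) ((p ^ 1 : ℕ) : ℤ)) 𝔓) ↔
        X ∈ selmerLocalKer (W.baseChange K) (v.adicCompletion K) ((p ^ 1 : ℕ) : ℤ) := by
  intro v hbad hpv X
  constructor
  · intro h
    obtain ⟨𝔓, h𝔓⟩ := HeightOneSpectrum.primesAbove_nonempty v
    rw [selmerLocalKer_eq_unramifiedKer_of_not_dvd_localTamagawaNumber_pow (W.baseChange K) p hpv (htam v hbad hpv) 1 h𝔓]
    exact h 𝔓 h𝔓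
  · intro h 𝔓 h𝔓
    rwa [selmerLocalKer_eq_unramifiedKer_of_not_dvd_localTamagawaNumber_pow (W.baseChange K) p hpv (htam v hbad hpv) 1 h𝔓] at h

end Tam

/-! ## §2 The rank-one dictionary under (Tam) -/

section Dictionary

variable {K : Type} [Field K] [NumberField K] (W : WeierstrassCurve ℚ) [W.IsElliptic] [W.IsGloballyMinimal] {p : ℕ} [Fact p.Prime]
  (κ : ZpExtension K p) {𝔭 𝔭' : HeightOneSpectrum (𝓞 K)}

/-- **The rank-one dictionary under (Tam)**: `T X ∈ Sel^ε_1(K_0, E[p]) ⟺ X ∈ Sel_p(E/K)` for every `X ∈ H¹(K, E[p])`, given the `Setting`, (Heeg)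
for `N_E`, the named print fact {HLV 2022 Lemma 3.7, local form} and (Tam) «`p ∤ c_v(E/K)` at the bad `v ∤ p`»
(`…RankOneDictionary.resH1Hom_layerZero_mem_signedOrdSelmerTorsion_one_iff_mem_selmerGroup` with `hbad` discharged by §1).
[cite: CastellaEtAl2025, §7.2 (arXiv:2308.10474v2 p0030 L16–L27)] [cite: HatleyLeiVigni2022, Lemma 3.7, §1.2 (Tam)] [cite: MilneADT2006, Ch. I Prop. 3.8] -/
theorem resH1Hom_layerZero_mem_signedOrdSelmerTorsion_one_iff_mem_selmerGroup_of_tam (hS : Setting W K p κ 𝔭 𝔭')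
    (hH : SatisfiesHeegnerHypothesis (W.conductorNorm ℤ) K) (hloc : hatleyLeiVigni2022_lemma37_local_signedCondition_eq_kummer W K p κ 𝔭 𝔭')
    (htam : ∀ v : HeightOneSpectrum (𝓞 K), ¬ (W.baseChange K).HasGoodReductionAt v → ((p : ℕ) : 𝓞 K) ∉ v.asIdeal →
      ¬ p ∣ ((W.baseChange K).baseChange (v.adicCompletion K)).localTamagawaNumber (v.adicCompletionIntegers K))
    (ε : ℤˣ) (X : Vp W K p) :
    resH1Hom (Literature.NumberTheory.EllipticCurves.subgroupIncl (κ.layerSubgroup 0))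
        (AddSubgroup.inclusion (geomTorsion_natCast_pow_one W (K := K) (p := p)).le) (fun _ _ ↦ rfl) X ∈
        signedOrdSelmerTorsion (W.baseChange K) p κ ε 1 0 1 ↔
      X ∈ selmerGroup (W.baseChange K) ((p ^ 1 : ℕ) : ℤ) :=
  resH1Hom_layerZero_mem_signedOrdSelmerTorsion_one_iff_mem_selmerGroup W κ hS hH hloc
    (kummer_iff_unramified_of_not_dvd_localTamagawaNumber W htam) ε X

end Dictionary

/-! ## §3 Howard's criterion at the root mod `𝔪` on the all-ramified cell — all hypotheses standard -/

section Assembly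

variable {K : Type} [Field K] [NumberField K] {W : WeierstrassCurve ℚ} [W.IsElliptic] [W.IsGloballyMinimal] {p : ℕ} [Fact p.Prime]
  {κ : ZpExtension K p} {γ : absoluteGaloisGroup K} {N : ℕ} {ε : ℤˣ} {B : SignedBipartiteSystem W K p κ} {𝔭 𝔭' : HeightOneSpectrum (𝓞 K)}

/-- **Howard's criterion at the root modulo `𝔪` on the all-ramified cell, every hypothesis standard.**  For a signed bipartite system `B` of sign `ε`
at level `N = N_E` (CHKLL25 Thm. 7.4) with limit base class `z`, on the frame (`AcSigned.Setting`; `p ≥ 5`, `ρ̄_{E,p}` onto, every `ℓ ∣ N` split,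
`(N, d_K) = 1`), GIVEN the named print fact {Hatley–Lei–Vigni 2022 Lemma 3.7, local form}, (Tam) «`p ∤ c_v(E/K)` at every bad `v ∤ p`», binder (ii)
«`E[p]` ramified at every `q ∣ N`» and [NV] `B.HasUnitLambda N`: if the classical `p`-Selmer group `Sel_p(E/K) ⊆ H¹(K, E[p])` is a line `ℤ·s`,
`s ≠ 0`, then **`z_{0,1} ≠ 0`**.  (`…RankOneDictionary.limitBaseClass_layer_zero_one_ne_zero_of_hasUnitLambda_of_selmerGroup_line` with (KU)
discharged by §1.) [cite: Howard2006, Thm. 3.2.3 (c)] [cite: CastellaEtAl2025, Thm. 7.1 (ii), Thm. 7.4, Thm. 7.5 (arXiv:2308.10474v2 pp. 29–31)]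
[cite: HatleyLeiVigni2022, Lemma 3.7, §1.2 (Tam)] [cite: MilneADT2006, Ch. I Prop. 3.8 and Remark 3.10] -/
theorem limitBaseClass_layer_zero_one_ne_zero_of_hasUnitLambda_of_selmerGroup_line_of_tam (hB : IsSignedBipartiteSystem W K p κ γ N ε B)
    {z : Π n j : ℕ, (W.baseChange K).torsionH1Over ((p : ℤ) ^ j) (κ.layerSubgroup n)} (hz : B.IsLimitBaseClass z)
    (hS : Setting W K p κ 𝔭 𝔭') (hloc : hatleyLeiVigni2022_lemma37_local_signedCondition_eq_kummer W K p κ 𝔭 𝔭')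
    (htam : ∀ v : HeightOneSpectrum (𝓞 K), ¬ (W.baseChange K).HasGoodReductionAt v → ((p : ℕ) : 𝓞 K) ∉ v.asIdeal →
      ¬ p ∣ ((W.baseChange K).baseChange (v.adicCompletion K)).localTamagawaNumber (v.adicCompletionIntegers K))
    (hN : (N : ℤ) = W.conductorNorm ℤ) (h5 : 5 ≤ p) (hsurj : W.HasSurjectiveModNGaloisRep p)
    (hH : SatisfiesHeegnerHypothesis (W.conductorNorm ℤ) K) (hsp : ((Ideal.span {(p : ℤ)}).primesOver (𝓞 K)).ncard = 2)
    (hND : IsCoprime (N : ℤ) (NumberField.discr K))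
    (hall : ∀ q : ℕ, q.Prime → q ∣ N → ∃ v' : HeightOneSpectrum (𝓞 ℚ), ((q : ℕ) : 𝓞 ℚ) ∈ v'.asIdeal ∧
      ∃ 𝔓 ∈ v'.primesAbove, ∃ σ ∈ 𝔓.inertia (absoluteGaloisGroup ℚ), ∃ P : W.geomTorsion (p : ℤ), σ • P ≠ P)
    {s : Vp W K p} (hs : s ∈ selmerGroup (W.baseChange K) ((p ^ 1 : ℕ) : ℤ)) (hs0 : s ≠ 0)
    (hline : ∀ c ∈ selmerGroup (W.baseChange K) ((p ^ 1 : ℕ) : ℤ), ∃ a : ℤ, c = a • s)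
    (hNV : B.HasUnitLambda N) : z 0 1 ≠ 0 :=
  limitBaseClass_layer_zero_one_ne_zero_of_hasUnitLambda_of_selmerGroup_line hB hz hS hloc
    (kummer_iff_unramified_of_not_dvd_localTamagawaNumber W htam) hN h5 hsurj hH hsp hND hall hs hs0 hline hNV

end Assembly

end Summit.BirchSwinnertonDyer.BirchSwinnertonDyer.Theorems.SignedBaseChangeAcDivAdmdefRankOneTamagawa

end
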